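/-
Copyright: seat `ym-line-sll-p5` (prover-ym-line-sll-p5-g0-0), route `SoftLoopLongLag`, crux `SoftLoopLagFloorToTorus`
(stmt-QuantumFields-22504), line `birth` (skeleton `Cruxes/SoftLoopLagFloorToTorus/Lines/birth.lean`, v3), stub K2 `stub_meanSmoothG`.
-/
import Summits.QuantumFields.YangMills.Theorems.SoftLoopLongLagColdBoxSoftLoopLagFloorStubGaussCore
import Summits.QuantumFields.YangMills.Theorems.WeakCouplingRatesBulkDominatesColdBoxWMeanSmoothOfExpansion
import Summits.QuantumFields.YangMills.Theorems.WeakCouplingRatesBulkDominatesColdBoxWDirKernelDiagFlat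

/-!
# Crux `SoftLoopLagFloorToTorus` (stmt-QuantumFields-22504), line `birth`, stub K2 `stub_meanSmoothG` — G-free BRICKS of the E2 reduction
# (inner-datum mean smoothness of the cube-smeared soft loops): flat Dirichlet LOOP variance, telescoped background flux², loop sums
# under translations, and the per-loop exponent bookkeeping

Consumed by `Theorems/SoftLoopLongLagInnerMeanSmoothLoopG.lean` (`innerMeanSmoothLoopG_of_loopMeanExpansion`: E2 ⇐ a one-scale LOOP
kernel-mean expansion N2L-G), the loop analogue of the sibling route's `goodBoundaryMeanSmoothG_of_expansion_explicit` (L1b-G ⇐ N2-G ∧ N1′).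
Companion bricks by the width seat `ym-line-sll-p4` (same statements in another dress, landed first): `SoftLoopLongLagDirichletLoopInductance`
(`exists_abs_dirInductance_shift_sub_le`), `SoftLoopLongLagBackgroundLoopFlux` (`abs_backgroundFlux_sq_shift_sub_le`), `SoftLoopLongLagLoopTranslation`;
the versions here are the RANGE-form / `(p.1, 1, 2)`-form variants the reduction consumes verbatim.

* §1 Brick (i) `abs_loopDirVariance_shift_sub_le` (N1′ for loops): the temporal-gauge Dirichlet variance of the loop circulation,
  `V_D(ℓ_y) = Σ_{p,q ∈ rectSurface y R R} boxDirProjKernel H p q`, is flat under translations near the centre of the cold box,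
  `|V_D(ℓ_{y+v}) − V_D(ℓ_y)| ≤ 2K·R⁴/H⁴` (`H ≥ 32`, all plaquettes within `H/8` of the centre): every one of the `R⁴` kernel entries is within
  `K/H⁴` of the translation-invariant `ℤ⁴` curl kernel (LANDED `exists_boxDirProjKernel_sub_curl_bound`, `curl_greenTensor_shift`).
* §1 Brick (ii) `abs_sum_surfaceFluxSq_sub_le`: for plaquette functions `F c` with interior sup bound `S_c/H²` and time-gradient bound
  `S_c/H³` on the surface base points (for the Dirichlet background of a datum: `dirBackground_interior_bounds`, `S_c = C√E_c`), the surface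
  fluxes `Φ_c(t) = Σ_{p ∈ rectSurface (y + t e₀) R R} F c p` obey `|Σ_c Φ_c(T)² − Σ_c Φ_c(0)²| ≤ T·2R⁴(Σ_c S_c²)/H⁵` (telescoping).
* §2 geometry and arithmetic: `near_centre_cube` (cube loops translated to the centre stay within `H/8` when `16R ≤ H`), `loopMean_assembly_le` (`β·N·|ΔE| ≤ 2e + (D/2)|ΔV| + β|ΔB|`), `loopMean_exponent_arith`
  (`⇒ (4 + K + 1250C²)(D+1)(|CE|+1)·R⁵β^{κ−1}/H`).

HONEST LABEL: rung R2xi-G RECORD label (leaf `WeakCouplingRates.XiPow`, an UPPER bound on the lattice mass gap for every compact simple `G`);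
NOT the Clay mass gap; no summit statement is touched.  No new definition; standard axioms; no `sorry`.

References: H.-O. Georgii, *Gibbs Measures and Phase Transitions* (2011) (5.3); G. Lawler, *Intersections of Random Walks* (1991) §1.5;
S. Chatterjee, arXiv:1803.01950 §4.
-/

set_option autoImplicit false

noncomputable section

open MeasureTheory Finset
open Literature.Probability.LatticeModels (Site box mem_box)
open Literature.MathematicalPhysics Literature.MathematicalPhysics.QuantumFieldTheory
open Literature.MathematicalPhysics.QuantumLattice
open Literature.MathematicalPhysics.QuantumFieldTheory.LatticeMaxwell
open Literature.MathematicalPhysics.QuantumFieldTheory.AxialGauge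
open Literature.MathematicalPhysics.QuantumFieldTheory.LatticeChain
open Literature.MathematicalPhysics.QuantumFieldTheory.LatticeForm (e d₁)
open Summit.QuantumFields.YangMills.Theorems.WeakCouplingRates

namespace Summit.QuantumFields.YangMills.Theorems.SoftLoopLongLag

/-! ## §1 G-free bricks: flat Dirichlet loop variance, telescoped background flux² -/

/-- Telescoping a square: if `|Φ t| ≤ A` for `t ≤ T` and `|Φ (t+1) − Φ t| ≤ B` for `t < T`, then `|Φ T² − Φ 0²| ≤ T·B·2A`. -/
theorem abs_sq_sub_sq_le_of_steps (Φ : ℕ → ℝ) (A B : ℝ) (T : ℕ) (hA : ∀ t : ℕ, t ≤ T → |Φ t| ≤ A)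
    (hB : ∀ t : ℕ, t + 1 ≤ T → |Φ (t + 1) - Φ t| ≤ B) :
    |Φ T ^ 2 - Φ 0 ^ 2| ≤ (T : ℝ) * (B * (2 * A)) := by
  rw [← Finset.sum_range_sub (fun t => Φ t ^ 2) T]
  refine (Finset.abs_sum_le_sum_abs _ _).trans ?_
  calc ∑ i ∈ range T, |Φ (i + 1) ^ 2 - Φ i ^ 2| ≤ ∑ _i ∈ range T, B * (2 * A) :=
        Finset.sum_le_sum fun i hi =>
          abs_sq_sub_sq_le (hA i (mem_range.1 hi).le) (hA (i + 1) (mem_range.1 hi)) (hB i (mem_range.1 hi))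
    _ = (T : ℝ) * (B * (2 * A)) := by rw [sum_const, card_range, nsmul_eq_mul]

/-- A surface sum of `R²` terms each bounded by `A` is bounded by `R²·A`. -/
theorem abs_sum_range_sum_range_le {R : ℕ} {f : ℕ → ℕ → ℝ} {A : ℝ} (h : ∀ a b : ℕ, a < R → b < R → |f a b| ≤ A) :
    |∑ a ∈ range R, ∑ b ∈ range R, f a b| ≤ (R : ℝ) ^ 2 * A := by
  calc |∑ a ∈ range R, ∑ b ∈ range R, f a b| ≤ ∑ a ∈ range R, |∑ b ∈ range R, f a b| := abs_sum_le_sum_abs _ _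
    _ ≤ ∑ a ∈ range R, ∑ b ∈ range R, |f a b| := sum_le_sum fun a _ => abs_sum_le_sum_abs _ _
    _ ≤ ∑ a ∈ range R, ∑ _b ∈ range R, A := sum_le_sum fun a ha => sum_le_sum fun b hb => h a b (mem_range.1 ha) (mem_range.1 hb)
    _ = (R : ℝ) ^ 2 * A := by rw [sum_const, card_range, nsmul_eq_mul, sum_const, card_range, nsmul_eq_mul]; ring

/-- Four-fold range sums: a termwise bound `|f − g| ≤ B` gives `|Σ f − Σ g| ≤ R²·(R²·B)`. -/
theorem abs_sum4_sub_sum4_le {R : ℕ} {f g : ℕ → ℕ → ℕ → ℕ → ℝ} {B : ℝ}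
    (h : ∀ a b a' b' : ℕ, a < R → b < R → a' < R → b' < R → |f a b a' b' - g a b a' b'| ≤ B) :
    |(∑ a ∈ range R, ∑ b ∈ range R, ∑ a' ∈ range R, ∑ b' ∈ range R, f a b a' b') -
        (∑ a ∈ range R, ∑ b ∈ range R, ∑ a' ∈ range R, ∑ b' ∈ range R, g a b a' b')| ≤
      (R : ℝ) ^ 2 * ((R : ℝ) ^ 2 * B) := by
  rw [← Finset.sum_sub_distrib]
  simp_rw [← Finset.sum_sub_distrib]
  exact abs_sum_range_sum_range_le fun a b ha hb =>
    abs_sum_range_sum_range_le fun a' b' ha' hb' => h a b a' b' ha hb ha' hb'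

/-- Termwise form of brick (i): from the two-plaquette comparison `|k_D(p,q) − (d₁ div₂ g_q)(p)| ≤ K/H⁴` near the centre and the
translation invariance of the `ℤ⁴` curl kernel, `|k_D(P+v, Q+v) − k_D(P, Q)| ≤ 2K/H⁴` for `(1,2)`-plaquettes based at `P, Q, P+v, Q+v`
within `H/8` of the centre. -/
theorem abs_boxDirProjKernel_shift_sub_le_of_bound {K : ℝ} {H : ℕ}
    (hK : ∀ (p q : Plaq 4), p.2.1 < p.2.2 → q.2.1 < q.2.2 →
      ‖p.1 - boxCentre H‖ ≤ (H : ℝ) / 8 → ‖q.1 - boxCentre H‖ ≤ (H : ℝ) / 8 →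
      |boxDirProjKernel H p q - d₁ (div₂ (greenTensor q)) p.1 p.2.1 p.2.2| ≤ K / (H : ℝ) ^ 4)
    (P Q v : Site 4) (hP : ‖P - boxCentre H‖ ≤ (H : ℝ) / 8) (hQ : ‖Q - boxCentre H‖ ≤ (H : ℝ) / 8)
    (hPv : ‖P + v - boxCentre H‖ ≤ (H : ℝ) / 8) (hQv : ‖Q + v - boxCentre H‖ ≤ (H : ℝ) / 8) :
    |boxDirProjKernel H (P + v, 1, 2) (Q + v, 1, 2) - boxDirProjKernel H (P, 1, 2) (Q, 1, 2)| ≤ 2 * K / (H : ℝ) ^ 4 := by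
  have h12 : (1 : Fin 4) < 2 := by decide
  have h1 := hK ((P + v, 1, 2) : Plaq 4) ((Q + v, 1, 2) : Plaq 4) h12 h12 hPv hQv
  have h2 := hK ((P, 1, 2) : Plaq 4) ((Q, 1, 2) : Plaq 4) h12 h12 hP hQ
  simp only at h1 h2
  rw [curl_greenTensor_shift Q P v 1 2 1 2] at h1
  rw [abs_sub_comm] at h2
  have h3 := (abs_sub_le _ (d₁ (div₂ (greenTensor ((Q, 1, 2) : Plaq 4))) P 1 2) _).trans (add_le_add h1 h2)
  refine h3.trans (le_of_eq ?_)
  ring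

/-- **Brick (i), G-free: the temporal-gauge Dirichlet variance of the `R×R` loop circulation is flat under translations near the
centre of the cold box `{0,…,2H}⁴`, rate `H⁻⁴`.**  With the constant `K` of `exists_boxDirProjKernel_sub_curl_bound`: for `H ≥ 32`,
if every plaquette base point `y + a e₁ + b e₂` and `y + v + a e₁ + b e₂` (`a, b < R`) lies within sup-distance `H/8` of the centre, then
`|V_D(y+v) − V_D(y)| ≤ 2K·R⁴/H⁴`, `V_D(y) = Σ_{p, q ∈ rectSurface y R R} boxDirProjKernel H p q` (both double sums are within `K R⁴/H⁴` of
the translation-invariant `ℤ⁴` curl kernel sum, `curl_greenTensor_shift`). -/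
theorem abs_loopDirVariance_shift_sub_le : ∃ K : ℝ, 0 ≤ K ∧ ∀ (H : ℕ), (32 : ℝ) ≤ H → ∀ (R : ℕ) (y v : Site 4),
    (∀ a b : ℕ, a < R → b < R → ‖y + Pi.single 1 (a : ℤ) + Pi.single 2 (b : ℤ) - boxCentre H‖ ≤ (H : ℝ) / 8) →
    (∀ a b : ℕ, a < R → b < R → ‖y + v + Pi.single 1 (a : ℤ) + Pi.single 2 (b : ℤ) - boxCentre H‖ ≤ (H : ℝ) / 8) →
    |(∑ p ∈ rectSurface (y + v) R R, ∑ q ∈ rectSurface (y + v) R R, boxDirProjKernel H (p.1, 1, 2) (q.1, 1, 2)) -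
        (∑ p ∈ rectSurface y R R, ∑ q ∈ rectSurface y R R, boxDirProjKernel H (p.1, 1, 2) (q.1, 1, 2))| ≤
      2 * K * (R : ℝ) ^ 4 / (H : ℝ) ^ 4 := by
  obtain ⟨K, hK0, hK⟩ := exists_boxDirProjKernel_sub_curl_bound
  refine ⟨K, hK0, fun H hH R y v hy hyv => ?_⟩
  have hb := abs_boxDirProjKernel_shift_sub_le_of_bound (hK H hH)
  -- range form of the two double sums, then sum the termwise bounds `2K/H⁴`
  rw [sum_rectSurface_eq (y + v), sum_rectSurface_eq y]
  simp_rw [sum_rectSurface_eq (y + v) R R, sum_rectSurface_eq y R R]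
  have hmain := abs_sum4_sub_sum4_le (R := R) (B := 2 * K / (H : ℝ) ^ 4)
    (f := fun a b a' b' => boxDirProjKernel H (y + v + Pi.single 1 (a : ℤ) + Pi.single 2 (b : ℤ), 1, 2)
      (y + v + Pi.single 1 (a' : ℤ) + Pi.single 2 (b' : ℤ), 1, 2))
    (g := fun a b a' b' => boxDirProjKernel H (y + Pi.single 1 (a : ℤ) + Pi.single 2 (b : ℤ), 1, 2)
      (y + Pi.single 1 (a' : ℤ) + Pi.single 2 (b' : ℤ), 1, 2))
    (fun a b a' b' ha hb' ha' hb'' => by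
      have hPv : y + v + Pi.single 1 (a : ℤ) + Pi.single 2 (b : ℤ) = y + Pi.single 1 (a : ℤ) + Pi.single 2 (b : ℤ) + v := by
        abel
      have hQv : y + v + Pi.single 1 (a' : ℤ) + Pi.single 2 (b' : ℤ) =
          y + Pi.single 1 (a' : ℤ) + Pi.single 2 (b' : ℤ) + v := by
        abel
      simp only [hPv, hQv]
      exact hb _ _ v (hy a b ha hb') (hy a' b' ha' hb'') (by rw [← hPv]; exact hyv a b ha hb')
        (by rw [← hQv]; exact hyv a' b' ha' hb''))
  refine hmain.trans (le_of_eq ?_)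
  ring

/-- Time steps of the plaquette base points: `y + (t+1)e₀ + a e₁ + b e₂ = (y + t e₀ + a e₁ + b e₂) + e₀`. -/
theorem base_point_succ (y : Site 4) (t : ℕ) (a b : ℤ) :
    y + Pi.single 0 (((t + 1 : ℕ) : ℤ)) + Pi.single 1 a + Pi.single 2 b =
      y + Pi.single 0 (t : ℤ) + Pi.single 1 a + Pi.single 2 b + Pi.single 0 1 := by
  rw [Nat.cast_succ, Pi.single_add]
  abel

/-- **Brick (ii), G-free: the background flux² term of the loop mean, telescoped over `T` unit time steps.**  For plaquette functions
`F c : Site 4 → ℝ` (one per colour `c < D`) with the interior SUP bound `|F c z| ≤ S c / H²` and the interior time-GRADIENT bound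
`|F c (z + e₀) − F c z| ≤ S c / H³` at every surface base point `z = y + t e₀ + a e₁ + b e₂` (`t ≤ T`, `a, b < R`) — for the Dirichlet
background of a datum these are `dirBackground_interior_bounds` with `S c = C·√(energy of colour c)` — the surface fluxes
`Φ_c(t) = Σ_{p ∈ rectSurface (y + t e₀) R R} F c p` satisfy `|Σ_c Φ_c(T)² − Σ_c Φ_c(0)²| ≤ T · 2R⁴ · (Σ_c S c²) / H⁵`
(each step `|Φ² − Φ'²| ≤ |Φ − Φ'|·(|Φ| + |Φ'|) ≤ (R² S/H³)(2 R² S/H²)`). -/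
theorem abs_sum_surfaceFluxSq_sub_le {D : ℕ} (F : Fin D → Site 4 → ℝ) (S : Fin D → ℝ) (H : ℝ) (y : Site 4) (R T : ℕ)
    (hsup : ∀ (c : Fin D) (t a b : ℕ), t ≤ T → a < R → b < R →
      |F c (y + Pi.single 0 (t : ℤ) + Pi.single 1 (a : ℤ) + Pi.single 2 (b : ℤ))| ≤ S c / H ^ 2)
    (hgrad : ∀ (c : Fin D) (t a b : ℕ), t + 1 ≤ T → a < R → b < R →
      |F c (y + Pi.single 0 (t : ℤ) + Pi.single 1 (a : ℤ) + Pi.single 2 (b : ℤ) + Pi.single 0 1) -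
          F c (y + Pi.single 0 (t : ℤ) + Pi.single 1 (a : ℤ) + Pi.single 2 (b : ℤ))| ≤ S c / H ^ 3) :
    |(∑ c, (∑ p ∈ rectSurface (y + Pi.single 0 (T : ℤ)) R R, F c p.1) ^ 2) -
        (∑ c, (∑ p ∈ rectSurface y R R, F c p.1) ^ 2)| ≤
      (T : ℝ) * (2 * (R : ℝ) ^ 4 * (∑ c, S c ^ 2) / H ^ 5) := by
  -- the surface flux of colour `c` at time step `t`, in range form
  set Φ : Fin D → ℕ → ℝ := fun c t => ∑ a ∈ range R, ∑ b ∈ range R,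
    F c (y + Pi.single 0 (t : ℤ) + Pi.single 1 (a : ℤ) + Pi.single 2 (b : ℤ)) with hΦ
  have hΦT : ∀ c, ∑ p ∈ rectSurface (y + Pi.single 0 (T : ℤ)) R R, F c p.1 = Φ c T := fun c => by
    rw [hΦ, sum_rectSurface_eq]
  have hΦ0 : ∀ c, ∑ p ∈ rectSurface y R R, F c p.1 = Φ c 0 := fun c => by
    rw [hΦ, sum_rectSurface_eq]
    simp only [Nat.cast_zero, Pi.single_zero, add_zero]
  simp_rw [hΦT, hΦ0]
  -- sup and step bounds of `Φ c`
  have hA : ∀ c (t : ℕ), t ≤ T → |Φ c t| ≤ (R : ℝ) ^ 2 * (S c / H ^ 2) := fun c t ht =>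
    abs_sum_range_sum_range_le fun a b ha hb => hsup c t a b ht ha hb
  have hB : ∀ c (t : ℕ), t + 1 ≤ T → |Φ c (t + 1) - Φ c t| ≤ (R : ℝ) ^ 2 * (S c / H ^ 3) := by
    intro c t ht
    have hsub : Φ c (t + 1) - Φ c t = ∑ a ∈ range R, ∑ b ∈ range R,
        (F c (y + Pi.single 0 (t : ℤ) + Pi.single 1 (a : ℤ) + Pi.single 2 (b : ℤ) + Pi.single 0 1) -
          F c (y + Pi.single 0 (t : ℤ) + Pi.single 1 (a : ℤ) + Pi.single 2 (b : ℤ))) := by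
      rw [hΦ]
      simp only
      rw [← Finset.sum_sub_distrib]
      refine Finset.sum_congr rfl fun a _ => ?_
      rw [← Finset.sum_sub_distrib]
      refine Finset.sum_congr rfl fun b _ => ?_
      rw [base_point_succ]
    rw [hsub]
    exact abs_sum_range_sum_range_le fun a b ha hb => hgrad c t a b ht ha hb
  -- telescope each colour and sum
  have hcol : ∀ c, |Φ c T ^ 2 - Φ c 0 ^ 2| ≤ (T : ℝ) * ((R : ℝ) ^ 2 * (S c / H ^ 3) * (2 * ((R : ℝ) ^ 2 * (S c / H ^ 2)))) :=
    fun c => abs_sq_sub_sq_le_of_steps (Φ c) _ _ T (hA c) (hB c)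
  rw [← Finset.sum_sub_distrib]
  refine (Finset.abs_sum_le_sum_abs _ _).trans ((Finset.sum_le_sum fun c _ => hcol c).trans (le_of_eq ?_))
  rw [Finset.mul_sum, Finset.sum_div, Finset.mul_sum]
  refine Finset.sum_congr rfl fun c _ => ?_
  ring

/-! ## §2 Geometry of the cube loops and the per-loop arithmetic -/

/-- Plaquette base points of the cube loops translated to the box centre are within `H/8` of the centre (integer form) when
`16 R ≤ H`: for `x ∈ timeZeroCube R`, `t, a, b ≤ R`, every coordinate of `x + centre + t e₀ + a e₁ + b e₂` is within `2R` of `H`. -/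
theorem near_centre_cube {H R : ℕ} (h16 : 16 * R ≤ H) {x : Site 4} (hx : x ∈ timeZeroCube R) {t a b : ℕ}
    (ht : t ≤ R) (ha : a ≤ R) (hb : b ≤ R) (m : Fin 4) :
    8 * |(x + boxCentre H + Pi.single 0 (t : ℤ) + Pi.single 1 (a : ℤ) + Pi.single 2 (b : ℤ) : Site 4) m - (H : ℤ)| ≤ (H : ℤ) := by
  simp only [timeZeroCube, Finset.mem_filter, mem_box] at hx
  obtain ⟨hbox, hx0⟩ := hx
  have h0 := hbox 0
  have h1 := hbox 1
  have h2 := hbox 2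
  have h3 := hbox 3
  have key : |(x + boxCentre H + Pi.single 0 (t : ℤ) + Pi.single 1 (a : ℤ) + Pi.single 2 (b : ℤ) : Site 4) m - (H : ℤ)| ≤ 2 * R := by
    rw [abs_le]
    fin_cases m <;> simp [boxCentre] <;> omega
  have hk := mul_le_mul_of_nonneg_left key (by norm_num : (0 : ℤ) ≤ 8)
  have h16' : (16 * R : ℤ) ≤ H := by exact_mod_cast h16
  linarith

/-- The base points themselves (`a = b = 0`). -/
theorem near_centre_cube_base {H R : ℕ} (h16 : 16 * R ≤ H) {x : Site 4} (hx : x ∈ timeZeroCube R) {t : ℕ} (ht : t ≤ R)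
    (m : Fin 4) : 8 * |(x + boxCentre H + Pi.single 0 (t : ℤ) : Site 4) m - (H : ℤ)| ≤ (H : ℤ) := by
  simpa using near_centre_cube h16 hx ht (Nat.zero_le R) (Nat.zero_le R) m

/-- Assembly of the per-loop bound (pure algebra): two expansion residuals `≤ e`, the variance difference and the background
difference give `β·N·|E_T − E_0| ≤ 2e + (D/2)|V_T − V_0| + β|B_T − B_0|`. -/
theorem loopMean_assembly_le {β N D E₀ E₁ V₀ V₁ B₀ B₁ e : ℝ} (hβ : 0 < β) (hN : 0 ≤ N) (hD : 0 ≤ D)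
    (h₀ : |β * (N - N * E₀) - D / 2 * V₀ - β * B₀| ≤ e) (h₁ : |β * (N - N * E₁) - D / 2 * V₁ - β * B₁| ≤ e) :
    β * (N * |E₁ - E₀|) ≤ 2 * e + D / 2 * |V₁ - V₀| + β * |B₁ - B₀| := by
  have hsplit : β * (N * (E₁ - E₀)) =
      (β * (N - N * E₀) - D / 2 * V₀ - β * B₀) - (β * (N - N * E₁) - D / 2 * V₁ - β * B₁) -
        D / 2 * (V₁ - V₀) - β * (B₁ - B₀) := by ring
  have habs : β * (N * |E₁ - E₀|) = |β * (N * (E₁ - E₀))| := by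
    rw [abs_mul, abs_mul, abs_of_pos hβ, abs_of_nonneg hN]
  rw [habs, hsplit]
  have hD2 : 0 ≤ D / 2 := by positivity
  calc |(β * (N - N * E₀) - D / 2 * V₀ - β * B₀) - (β * (N - N * E₁) - D / 2 * V₁ - β * B₁) -
          D / 2 * (V₁ - V₀) - β * (B₁ - B₀)|
      ≤ |(β * (N - N * E₀) - D / 2 * V₀ - β * B₀) - (β * (N - N * E₁) - D / 2 * V₁ - β * B₁) -
          D / 2 * (V₁ - V₀)| + |β * (B₁ - B₀)| := abs_sub _ _
    _ ≤ (|(β * (N - N * E₀) - D / 2 * V₀ - β * B₀) - (β * (N - N * E₁) - D / 2 * V₁ - β * B₁)| +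
          |D / 2 * (V₁ - V₀)|) + |β * (B₁ - B₀)| := by
        gcongr; exact abs_sub _ _
    _ ≤ ((|β * (N - N * E₀) - D / 2 * V₀ - β * B₀| + |β * (N - N * E₁) - D / 2 * V₁ - β * B₁|) +
          |D / 2 * (V₁ - V₀)|) + |β * (B₁ - B₀)| := by
        gcongr; exact abs_sub _ _
    _ ≤ ((e + e) + D / 2 * |V₁ - V₀|) + β * |B₁ - B₀| := by
        rw [abs_mul (D / 2), abs_of_nonneg hD2, abs_mul β, abs_of_pos hβ]
        gcongr
    _ = 2 * e + D / 2 * |V₁ - V₀| + β * |B₁ - B₀| := by ring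

/-- Exponent bookkeeping of the per-loop bound (pure arithmetic): with `β, R, H ≥ 1`, `H ≤ 2β^a`, `κ > 0`, energies
`S ≤ |CE|·625H⁴·β^{κ−1}`, from `β·X ≤ 2β^{−a} + (D/2)(2K R⁴/H⁴) + β·(R·(2R⁴(C²S)/H⁵))` one gets
`X ≤ (4 + K + 1250C²)(D+1)(|CE|+1) · R⁵β^{κ−1}/H`. -/
theorem loopMean_exponent_arith {β a κ R H K C CE D S X : ℝ} (hβ1 : 1 ≤ β) (hR1 : 1 ≤ R) (hH1 : 1 ≤ H)
    (hH2 : H ≤ 2 * β ^ a) (hκ : 0 < κ) (hK0 : 0 ≤ K) (hD0 : 0 ≤ D)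
    (hS : S ≤ |CE| * (625 * H ^ 4) * β ^ (κ - 1))
    (hX : β * X ≤ 2 * β ^ (-a) + D / 2 * (2 * K * R ^ 4 / H ^ 4) + β * (R * (2 * R ^ 4 * (C ^ 2 * S) / H ^ 5))) :
    X ≤ (4 + K + 1250 * C ^ 2) * (D + 1) * (|CE| + 1) * (R ^ 5 * β ^ (κ - 1) / H) := by
  have hβ0 : 0 < β := by linarith
  have hHpos : 0 < H := by linarith
  have hβκ1 : β⁻¹ ≤ β ^ (κ - 1) := by
    rw [Real.rpow_sub hβ0, Real.rpow_one, ← one_div]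
    exact div_le_div_of_nonneg_right (Real.one_le_rpow hβ1 hκ.le) hβ0.le
  have hβa : β ^ (-a) ≤ 2 / H := by
    rw [Real.rpow_neg hβ0.le, le_div_iff₀ hHpos]
    calc (β ^ a)⁻¹ * H ≤ (β ^ a)⁻¹ * (2 * β ^ a) := mul_le_mul_of_nonneg_left hH2 (inv_nonneg.2 (Real.rpow_nonneg hβ0.le _))
      _ = 2 := by rw [mul_comm (2 : ℝ), inv_mul_cancel_left₀ (Real.rpow_pos_of_pos hβ0 a).ne']
  have hR5 : (1 : ℝ) ≤ R ^ 5 := one_le_pow₀ hR1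
  have hβκ : 0 < β ^ (κ - 1) := Real.rpow_pos_of_pos hβ0 _
  have hXdiv : X ≤ β⁻¹ * (2 * β ^ (-a) + D / 2 * (2 * K * R ^ 4 / H ^ 4) + β * (R * (2 * R ^ 4 * (C ^ 2 * S) / H ^ 5))) := by
    rw [le_inv_mul_iff₀ hβ0]; exact hX
  have hX' : R ^ 5 * β ^ (κ - 1) / H = R ^ 5 * β ^ (κ - 1) * H⁻¹ := div_eq_mul_inv _ _
  have hunit : β⁻¹ * H⁻¹ ≤ R ^ 5 * β ^ (κ - 1) / H := by
    rw [hX']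
    calc β⁻¹ * H⁻¹ = 1 * β⁻¹ * H⁻¹ := by ring
      _ ≤ R ^ 5 * β ^ (κ - 1) * H⁻¹ := by gcongr
  have ht1 : β⁻¹ * (2 * β ^ (-a)) ≤ 4 * (R ^ 5 * β ^ (κ - 1) / H) := by
    calc β⁻¹ * (2 * β ^ (-a)) ≤ β⁻¹ * (2 * (2 / H)) := by gcongr
      _ = 4 * (β⁻¹ * H⁻¹) := by ring
      _ ≤ 4 * (R ^ 5 * β ^ (κ - 1) / H) := by gcongr
  have ht2 : β⁻¹ * (D / 2 * (2 * K * R ^ 4 / H ^ 4)) ≤ D * K * (R ^ 5 * β ^ (κ - 1) / H) := by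
    have hH4 : (H ^ 4)⁻¹ ≤ H⁻¹ := by
      refine inv_anti₀ hHpos ?_
      calc H = H ^ 1 := (pow_one _).symm
        _ ≤ H ^ 4 := pow_le_pow_right₀ hH1 (by norm_num)
    have hR4 : R ^ 4 ≤ R ^ 5 := pow_le_pow_right₀ hR1 (by norm_num)
    rw [hX']
    calc β⁻¹ * (D / 2 * (2 * K * R ^ 4 / H ^ 4)) = D * K * (R ^ 4 * β⁻¹ * (H ^ 4)⁻¹) := by ring
      _ ≤ D * K * (R ^ 5 * β ^ (κ - 1) * H⁻¹) := by gcongr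
  have ht3 : β⁻¹ * (β * (R * (2 * R ^ 4 * (C ^ 2 * S) / H ^ 5))) ≤ 1250 * C ^ 2 * |CE| * (R ^ 5 * β ^ (κ - 1) / H) := by
    rw [inv_mul_cancel_left₀ hβ0.ne']
    have hfrac : 2 * R ^ 4 * (C ^ 2 * S) / H ^ 5 ≤ 1250 * C ^ 2 * |CE| * R ^ 4 * β ^ (κ - 1) / H := by
      rw [div_le_div_iff₀ (by positivity) hHpos]
      calc 2 * R ^ 4 * (C ^ 2 * S) * H ≤ 2 * R ^ 4 * (C ^ 2 * (|CE| * (625 * H ^ 4) * β ^ (κ - 1))) * H := by gcongr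
        _ = 1250 * C ^ 2 * |CE| * R ^ 4 * β ^ (κ - 1) * H ^ 5 := by ring
    calc R * (2 * R ^ 4 * (C ^ 2 * S) / H ^ 5) ≤ R * (1250 * C ^ 2 * |CE| * R ^ 4 * β ^ (κ - 1) / H) :=
          mul_le_mul_of_nonneg_left hfrac (by linarith)
      _ = 1250 * C ^ 2 * |CE| * (R ^ 5 * β ^ (κ - 1) / H) := by ring
  have hcoef : 4 + D * K + 1250 * C ^ 2 * |CE| ≤ (4 + K + 1250 * C ^ 2) * (D + 1) * (|CE| + 1) := by
    have hCE0 : 0 ≤ |CE| := abs_nonneg _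
    have hC2 : 0 ≤ C ^ 2 := sq_nonneg _
    have e1 : (4 + K + 1250 * C ^ 2) * (D + 1) * (|CE| + 1) = (4 + D * K + 1250 * C ^ 2 * |CE|) +
        (4 * (D * |CE|) + 4 * D + 4 * |CE| + K * (D * |CE|) + K * |CE| + K + 1250 * (C ^ 2 * (D * |CE|)) +
          1250 * (C ^ 2 * D) + 1250 * C ^ 2) := by ring
    rw [e1]
    have h1 : 0 ≤ D * |CE| := mul_nonneg hD0 hCE0
    have h2 : 0 ≤ K * (D * |CE|) := mul_nonneg hK0 h1
    have h3 : 0 ≤ K * |CE| := mul_nonneg hK0 hCE0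
    have h4 : 0 ≤ C ^ 2 * (D * |CE|) := mul_nonneg hC2 h1
    have h5 : 0 ≤ C ^ 2 * D := mul_nonneg hC2 hD0
    linarith
  have hU0 : 0 ≤ R ^ 5 * β ^ (κ - 1) / H := by positivity
  calc X ≤ _ := hXdiv
    _ = β⁻¹ * (2 * β ^ (-a)) + β⁻¹ * (D / 2 * (2 * K * R ^ 4 / H ^ 4)) +
        β⁻¹ * (β * (R * (2 * R ^ 4 * (C ^ 2 * S) / H ^ 5))) := by ring
    _ ≤ 4 * (R ^ 5 * β ^ (κ - 1) / H) + D * K * (R ^ 5 * β ^ (κ - 1) / H) +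
        1250 * C ^ 2 * |CE| * (R ^ 5 * β ^ (κ - 1) / H) := add_le_add (add_le_add ht1 ht2) ht3
    _ = (4 + D * K + 1250 * C ^ 2 * |CE|) * (R ^ 5 * β ^ (κ - 1) / H) := by ring
    _ ≤ (4 + K + 1250 * C ^ 2) * (D + 1) * (|CE| + 1) * (R ^ 5 * β ^ (κ - 1) / H) := mul_le_mul_of_nonneg_right hcoef hU0

end Summit.QuantumFields.YangMills.Theorems.SoftLoopLongLag

end
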